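import Literature.Combinatorics.Optimization.PolytopePsdRankLowerBound
import Mathlib.NumberTheory.Real.Irrational
import Mathlib.FieldTheory.IntermediateField.Adjoin.Defs
import HarnessLib

/-!
# FGPRT worked examples: the square (Example 3.5), the nested rectangles (Example 3.6), the partition
# reduction behind the NP-hardness of the square root rank (Theorem 5.6), its `(5, 12, 13)` instance
# (Remark 5.7), and the prime matrices of full square root rank (Example 5.18) — all PROVED

Source: H. Fawzi, J. Gouveia, P. A. Parrilo, R. Z. Robinson, R. R. Thomas, *Positive semidefinite
rank*, Math. Program. Ser. B 153 (2015) 133–177 = arXiv:1407.4095 [FawziEtAl2015] (held text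
`paper:arxiv-1407.4095`; numbering of the arXiv version, `pNN` = held-text chunk). Completeness sweep of
§§3–5 for the typing row: the numbered items of those sections NOT covered by `PsdLiftSlackMatrix.lean`,
`PsdRankComparisons.lean`, `PolytopePsdRankLowerBound.lean`, `PsdLiftAlgebraicBoundary.lean`,
`PsdLiftUniformDegreeBound.lean`, `SpectrahedronRenegarDerivatives.lean` (same directory / tree) were
Example 3.5, Example 3.6, Theorem 5.6, Remark 5.7, Example 5.15, Example 5.18 (and the open Problem
5.16). This file PROVES five of them; no definitions of notions, no named facts.

* **Example 3.5** (p10): "Let `P = Q = [-1,1]²` … the slack matrix of `P` [is] `M = [[1,1,0,0],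
  [0,1,1,0],[0,0,1,1],[1,0,0,1]]`. One can construct the following psd factorization of `M` of size 3
  … `A_i = u_iu_iᵀ`, `B_j = v_jv_jᵀ` with `u = (1,0,0),(0,1,0),(0,0,1),(1,1,1)`, `v = (1,0,0),(1,-1,0),
  (0,1,-1),(0,0,1)` … no smaller representation of the square is possible: … `rank_psd M ≥ 2+1 = 3`."
  Here: `squareSlackMatrix` is the slack matrix of the vertex/facet descriptions `squareVertices`,
  `squareNormals` (`squareSlackMatrix_eq_pairSlackMatrix`, `convexHull_squareVertices`), the printed
  factorization (`hasPsdFactorization_squareSlackMatrix_three`), `rank M = 3` and `rank_psd M > 2` from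
  the tree's Corollary 5.9 (`squareSlackMatrix_rank_and_psdRank`), and the size-3 psd lift of the square
  by the tree's Theorem 3.3 (`hasPsdLift_square_three`; the text exhibits the elliptope).
* **Theorem 5.6** (p15): "The square root rank of a nonnegative matrix is NP-hard to compute." The
  complexity statement is not typed; its mathematical content — the printed reduction — is: for
  `a_1,…,a_n` let `A` be the `(n+1) × (n+1)` matrix `[[I_n, (a_i²)], [𝟙ᵀ, 0]]` (`partitionMatrix a`);
  "since `A` contains the `n × n` identity matrix as a submatrix, the square root rank of `A` must be
  either `n` or `n+1`" (`le_of_hasHadamardSqrtOfRankLE_partitionMatrix`,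
  `hasHadamardSqrtOfRankLE_partitionMatrix_succ`) and "there exists a Hadamard square root of rank `n`
  if and only if the partition problem for `a_1,…,a_n` is satisfiable", i.e. iff `Σ s_i a_i = 0` for
  some signs `s_i ∈ {±1}` (`hasHadamardSqrtOfRankLE_partitionMatrix_iff`; stated for real `a_i`, the
  printed positive-integer case being an instance).
* **Remark 5.7** (p15): for `(a_1,a_2,a_3) = (5,12,13)` "this instance of the partition problem is not
  satisfiable, yet the matrix `A` has a `3 × 3` psd factorization" (printed factors: the identity's
  standard factorization on the first three rows/columns, `[[1,0,-5/13],[0,1,-12/13],[-5/13,-12/13,1]]`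
  on the fourth row and `(5,12,13)(5,12,13)ᵀ` on the fourth column):
  `not_hasHadamardSqrtOfRankLE_partitionMatrix_5_12_13` (`rank_√ = 4`) and
  `hasPsdFactorization_partitionMatrix_5_12_13` (`rank_psd ≤ 3`) — an explicit integer matrix with
  `rank_psd < rank_√`.

* **Example 5.18** (p17, appended): "Let `n_1,n_2,…` be an increasing sequence of positive integers
  such that `2n_k − 1` is prime for each `k`. Let `𝒫_k` denote the set of all primes strictly less than
  `2n_k − 1`. Define a `k × k` matrix `Q^k` such that `Q^k_{ij} = n_i + n_j − 1`. Then `Q^k` has usual rank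
  two for all `k`. Consequently, by Proposition 2.8, the nonnegative rank and psd rank of `Q^k` are also
  two … We will prove by induction that `Q^k` has full square root rank for each `k`" (the printed
  induction: every entry of a Hadamard square root except the corner `x = ±√(2n_k−1)` lies in
  `ℚ(√𝒫_k)`, `det = αx + β` with `α ≠ 0` by induction, so `det = 0` would force `x ∈ ℚ(√𝒫_k)`).
  Here: `primeMatrix n`, `primeMatrix_rank_le_two` (rank `≤ 2` and an explicit nonnegative = psd
  factorization of size `2`), `det_ne_zero_of_sq_eq_primeMatrix` (every Hadamard square root is
  nonsingular) and `le_of_hasHadamardSqrtOfRankLE_primeMatrix` (`rank_√(Q^k) = k`). The one step the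
  text leaves implicit — `√(2n_k − 1) ∉ ℚ(√𝒫_k)` — is the special case of Besicovitch's theorem
  [Besicovitch1940] PROVED here as `sqrt_not_mem_sqrtField` (for a finite set `P` of primes and a
  squarefree `m > 1` with no prime factor in `P`, `√m ∉ ℚ(√p : p ∈ P)`; induction on `P` through
  `ℚ(√P,√p) = ℚ(√P) + ℚ(√P)√p`).

* **Example 3.6** (p10, appended): "Let `Q = [-1,1]²` and let now `P = [-a,a] × [-b,b]` … with
  `0 ≤ a,b ≤ 1`. The slack matrix of the pair `P,Q` … is `M = [[1+a,1+b,1−a,1−b],[1−a,1+b,1+a,1−b],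
  [1−a,1−b,1+a,1+b],[1+a,1−b,1−a,1+b]]` … `rank_psd M ≤ 3` for all `a,b ≤ 1` … the psd rank of `M` is
  equal to 2 if, and only if, there is an ellipse `E` such that `P ⊆ E ⊆ Q` … such an ellipse exists if
  and only if `a² + b² ≤ 1`. Thus `rank_psd M = 3` if `a² + b² > 1`, `2` if `0 < a² + b² ≤ 1`, `1` if
  `a = b = 0`." Here (`nestedRectangles_psdRank`): a size-3 factorization for all `0 ≤ a,b ≤ 1` through
  the elliptope's moment matrices `T(y) = [[1,y₁,y₂],[y₁,1,y₁y₂],[y₂,y₁y₂,1]]`; a size-2 factorization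
  through the disk `[[1+y₁,y₂],[y₂,1−y₁]] ⪰ 0` when `a² + b² ≤ 1`; the converse via the tree's §4
  criterion `FawziEtAl2015_sec4_ellipse_holds` (an ellipse between `P` and `Q`) and the printed "it is
  not hard to see" step done by averaging the ellipse's quadratic over the symmetries `(±y₁, ±y₂)`;
  size `1` iff `a = b = 0` (a `2 × 2` minor).

NOT here: Example 5.15 (rests on Scheiderer's planar lifts and Proposition 5.12), Problem 5.16 (open).
-/

noncomputable section

open Matrix Finset
open scoped MatrixOrder

namespace Literature.Combinatorics.Optimization

/-! ### Theorem 5.6: the partition matrix and its Hadamard square roots -/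

/-- **The matrix of FGPRT's reduction** (Theorem 5.6 proof, p15): for numbers `a_1,…,a_n` the
`(n+1) × (n+1)` matrix `[[I_n, (a_i²)_i], [𝟙ᵀ, 0]]`, indexed by `Fin n ⊕ Unit`.
[cite: FawziEtAl2015, Thm. 5.6 proof (p15)] -/
def partitionMatrix {n : ℕ} (a : Fin n → ℝ) : Matrix (Fin n ⊕ Unit) (Fin n ⊕ Unit) ℝ :=
  Matrix.fromBlocks 1 (Matrix.of fun i _ => a i ^ 2) (Matrix.of fun _ _ => 1) 0

/-- Upper-left block: the identity. [cite: FawziEtAl2015, Thm. 5.6 proof (p15)] -/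
@[simp] theorem partitionMatrix_inl_inl {n : ℕ} (a : Fin n → ℝ) (i j : Fin n) :
    partitionMatrix a (Sum.inl i) (Sum.inl j) = if i = j then 1 else 0 := by
  simp [partitionMatrix, one_apply]

/-- Last column: `a_i²`. [cite: FawziEtAl2015, Thm. 5.6 proof (p15)] -/
@[simp] theorem partitionMatrix_inl_inr {n : ℕ} (a : Fin n → ℝ) (i : Fin n) (u : Unit) :
    partitionMatrix a (Sum.inl i) (Sum.inr u) = a i ^ 2 := rfl

/-- Last row: ones. [cite: FawziEtAl2015, Thm. 5.6 proof (p15)] -/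
@[simp] theorem partitionMatrix_inr_inl {n : ℕ} (a : Fin n → ℝ) (u : Unit) (j : Fin n) :
    partitionMatrix a (Sum.inr u) (Sum.inl j) = 1 := rfl

/-- Corner: `0`. [cite: FawziEtAl2015, Thm. 5.6 proof (p15)] -/
@[simp] theorem partitionMatrix_inr_inr {n : ℕ} (a : Fin n → ℝ) (u u' : Unit) :
    partitionMatrix a (Sum.inr u) (Sum.inr u') = 0 := rfl

/-- The partition matrix is entrywise nonnegative. [cite: FawziEtAl2015, Thm. 5.6 proof (p15)] -/
theorem partitionMatrix_nonneg {n : ℕ} (a : Fin n → ℝ) (i j : Fin n ⊕ Unit) :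
    0 ≤ partitionMatrix a i j := by
  rcases i with i | u <;> rcases j with j | u'
  · rw [partitionMatrix_inl_inl]; split_ifs <;> norm_num
  · rw [partitionMatrix_inl_inr]; positivity
  · rw [partitionMatrix_inr_inl]; norm_num
  · rw [partitionMatrix_inr_inr]

/-- The shape of a Hadamard square root of the partition matrix: `±1` on the diagonal and `0` off it
in the identity block, `±a_i` in the last column, `±1` in the last row, `0` in the corner ("we may
scale rows and columns of `√A` by `−1`", p15). [cite: FawziEtAl2015, Thm. 5.6 proof (p15)] -/
private theorem sqrt_shape {n : ℕ} {a : Fin n → ℝ} {N : Matrix (Fin n ⊕ Unit) (Fin n ⊕ Unit) ℝ}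
    (hN : ∀ i j, N i j ^ 2 = partitionMatrix a i j) :
    (∀ i, N (Sum.inl i) (Sum.inl i) = 1 ∨ N (Sum.inl i) (Sum.inl i) = -1) ∧
    (∀ i j, i ≠ j → N (Sum.inl i) (Sum.inl j) = 0) ∧
    (∀ i, N (Sum.inl i) (Sum.inr ()) = a i ∨ N (Sum.inl i) (Sum.inr ()) = -a i) ∧
    (∀ j, N (Sum.inr ()) (Sum.inl j) = 1 ∨ N (Sum.inr ()) (Sum.inl j) = -1) ∧
    N (Sum.inr ()) (Sum.inr ()) = 0 := by
  refine ⟨fun i => ?_, fun i j hij => ?_, fun i => ?_, fun j => ?_, ?_⟩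
  · have h := hN (Sum.inl i) (Sum.inl i)
    rw [partitionMatrix_inl_inl, if_pos rfl] at h
    exact sq_eq_sq_iff_eq_or_eq_neg.mp (by rw [h, one_pow])
  · have h := hN (Sum.inl i) (Sum.inl j)
    rw [partitionMatrix_inl_inl, if_neg hij] at h
    exact pow_eq_zero_iff (n := 2) (by norm_num) |>.mp h
  · exact sq_eq_sq_iff_eq_or_eq_neg.mp (hN (Sum.inl i) (Sum.inr ()))
  · have h := hN (Sum.inr ()) (Sum.inl j)
    rw [partitionMatrix_inr_inl] at h
    exact sq_eq_sq_iff_eq_or_eq_neg.mp (by rw [h, one_pow])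
  · have h := hN (Sum.inr ()) (Sum.inr ())
    rw [partitionMatrix_inr_inr] at h
    exact pow_eq_zero_iff (n := 2) (by norm_num) |>.mp h

/-- **"Since `A` contains the `n × n` identity matrix as a submatrix, the square root rank of `A` must
be either `n` or `n+1`"** — every Hadamard square root has rank `≥ n` (its identity block is a signed
diagonal matrix). [cite: FawziEtAl2015, Thm. 5.6 proof (p15)] -/
theorem le_rank_of_sq_eq_partitionMatrix {n : ℕ} (a : Fin n → ℝ)
    {N : Matrix (Fin n ⊕ Unit) (Fin n ⊕ Unit) ℝ} (hN : ∀ i j, N i j ^ 2 = partitionMatrix a i j) :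
    n ≤ N.rank := by
  classical
  obtain ⟨hdiag, hoff, -, -, -⟩ := sqrt_shape hN
  have hsub : N.submatrix Sum.inl Sum.inl = diagonal fun i => N (Sum.inl i) (Sum.inl i) := by
    ext i j
    by_cases hij : i = j
    · subst hij; simp
    · rw [submatrix_apply, diagonal_apply_ne _ hij, hoff i j hij]
  have hdet : (N.submatrix Sum.inl Sum.inl).det ≠ 0 := by
    rw [hsub, det_diagonal]
    exact Finset.prod_ne_zero_iff.mpr fun i _ => by
      rcases hdiag i with h | h <;> rw [h] <;> norm_num
  have hrank : (N.submatrix Sum.inl Sum.inl).rank = n := by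
    rw [rank_of_isUnit _ ((isUnit_iff_isUnit_det _).mpr (isUnit_iff_ne_zero.mpr hdet)),
      Fintype.card_fin]
  calc n = (N.submatrix Sum.inl Sum.inl).rank := hrank.symm
    _ ≤ N.rank := rank_submatrix_le _ _ _

/-- `rank_√(A) ≥ n`. [cite: FawziEtAl2015, Thm. 5.6 proof (p15)] -/
theorem le_of_hasHadamardSqrtOfRankLE_partitionMatrix {n r : ℕ} (a : Fin n → ℝ)
    (h : HasHadamardSqrtOfRankLE (partitionMatrix a) r) : n ≤ r := by
  obtain ⟨N, hN, hr⟩ := h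
  exact (le_rank_of_sq_eq_partitionMatrix a hN).trans hr

/-- `rank_√(A) ≤ n + 1` (the entrywise square root has rank at most the size).
[cite: FawziEtAl2015, Thm. 5.6 proof (p15)] -/
theorem hasHadamardSqrtOfRankLE_partitionMatrix_succ {n : ℕ} (a : Fin n → ℝ) :
    HasHadamardSqrtOfRankLE (partitionMatrix a) (n + 1) := by
  classical
  refine ⟨Matrix.of fun i j => Real.sqrt (partitionMatrix a i j), fun i j => ?_, ?_⟩
  · rw [of_apply, Real.sq_sqrt (partitionMatrix_nonneg a i j)]
  · calc (Matrix.of fun i j => Real.sqrt (partitionMatrix a i j)).rank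
        ≤ Fintype.card (Fin n ⊕ Unit) := rank_le_card_width _
      _ = n + 1 := by simp

/-- **FGPRT Theorem 5.6, the reduction** (p15): "there exists a Hadamard square root of rank `n` if and
only if the partition problem for `a_1,…,a_n` is satisfiable" — `rank_√(A) ≤ n` iff `Σ_i s_i a_i = 0`
for some signs `s_i ∈ {±1}`. (⇐: `[[I],[𝟙ᵀ]] · [I | (s_ia_i)]` is a square root of rank `≤ n`; ⇒: a rank-
`≤ n` square root is singular, and a kernel vector read through the signed identity block yields the
signs.) Stated for real `a`; the printed case is `a_i ∈ ℤ_{>0}`. [cite: FawziEtAl2015, Thm. 5.6 (p15)] -/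
theorem hasHadamardSqrtOfRankLE_partitionMatrix_iff {n : ℕ} (a : Fin n → ℝ) :
    HasHadamardSqrtOfRankLE (partitionMatrix a) n ↔
      ∃ s : Fin n → ℝ, (∀ i, s i = 1 ∨ s i = -1) ∧ ∑ i, s i * a i = 0 := by
  classical
  constructor
  · rintro ⟨N, hN, hrank⟩
    obtain ⟨hdiag, hoff, hcol, hrow, hcorner⟩ := sqrt_shape hN
    -- `det N = 0` since `rank N ≤ n < n + 1`
    have hdet : N.det = 0 := by
      by_contra h
      have := rank_of_isUnit N ((isUnit_iff_isUnit_det _).mpr (isUnit_iff_ne_zero.mpr h))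
      simp only [Fintype.card_sum, Fintype.card_fin, Fintype.card_unique] at this
      omega
    obtain ⟨c, hc0, hc⟩ := exists_mulVec_eq_zero_iff.mpr hdet
    have hrowi : ∀ i, N (Sum.inl i) (Sum.inl i) * c (Sum.inl i) +
        N (Sum.inl i) (Sum.inr ()) * c (Sum.inr ()) = 0 := by
      intro i
      have h := congrFun hc (Sum.inl i)
      simp only [Pi.zero_apply, mulVec, dotProduct, Fintype.sum_sum_type, Fintype.sum_unique] at h
      rw [Finset.sum_eq_single i (f := fun j => N (Sum.inl i) (Sum.inl j) * c (Sum.inl j))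
        (fun j _ hji => by rw [hoff i j (Ne.symm hji), zero_mul])
        (fun h => absurd (Finset.mem_univ i) h)] at h
      exact h
    have hrowlast : ∑ j, N (Sum.inr ()) (Sum.inl j) * c (Sum.inl j) = 0 := by
      have h := congrFun hc (Sum.inr ())
      simp only [Pi.zero_apply, mulVec, dotProduct, Fintype.sum_sum_type, Fintype.sum_unique,
        hcorner, zero_mul, add_zero] at h
      exact h
    -- solve the first `n` equations: `c_i = -ε_i N_{i,*} c_*`
    have hci : ∀ i, c (Sum.inl i) = -(N (Sum.inl i) (Sum.inl i) * N (Sum.inl i) (Sum.inr ()) *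
        c (Sum.inr ())) := by
      intro i
      have hsq : N (Sum.inl i) (Sum.inl i) * N (Sum.inl i) (Sum.inl i) = 1 := by
        rcases hdiag i with h | h <;> rw [h] <;> norm_num
      have h := hrowi i
      calc c (Sum.inl i) = (N (Sum.inl i) (Sum.inl i) * N (Sum.inl i) (Sum.inl i)) * c (Sum.inl i) := by
            rw [hsq, one_mul]
        _ = _ := by linear_combination N (Sum.inl i) (Sum.inl i) * h
    have hcstar : c (Sum.inr ()) ≠ 0 := by
      intro h0
      apply hc0
      funext x
      rcases x with i | ⟨⟩
      · rw [hci i, h0, mul_zero, neg_zero, Pi.zero_apply]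
      · exact h0
    -- signs
    let τ : Fin n → ℝ := fun j => if N (Sum.inl j) (Sum.inr ()) = a j then 1 else -1
    have hτ : ∀ j, N (Sum.inl j) (Sum.inr ()) = τ j * a j := by
      intro j
      simp only [τ]
      split_ifs with h
      · rw [h, one_mul]
      · rcases hcol j with h' | h'
        · exact absurd h' h
        · rw [h', neg_one_mul]
    have hτs : ∀ j, τ j = 1 ∨ τ j = -1 := fun j => by
      simp only [τ]; split_ifs <;> simp
    refine ⟨fun j => N (Sum.inr ()) (Sum.inl j) * N (Sum.inl j) (Sum.inl j) * τ j, fun j => ?_, ?_⟩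
    · beta_reduce
      rcases hrow j with h1 | h1 <;> rcases hdiag j with h2 | h2 <;> rcases hτs j with h3 | h3 <;>
        rw [h1, h2, h3] <;> norm_num
    · have h : ∑ j, N (Sum.inr ()) (Sum.inl j) * N (Sum.inl j) (Sum.inl j) * τ j * a j =
          -(∑ j, N (Sum.inr ()) (Sum.inl j) * c (Sum.inl j)) / c (Sum.inr ()) := by
        rw [eq_div_iff hcstar, ← Finset.sum_neg_distrib, Finset.sum_mul]
        refine Finset.sum_congr rfl fun j _ => ?_
        rw [hci j, hτ j]
        ring
      rw [h, hrowlast, neg_zero, zero_div]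
  · rintro ⟨s, hs, hsum⟩
    have hs2 : ∀ i, s i ^ 2 = 1 := fun i => by rcases hs i with h | h <;> rw [h] <;> norm_num
    let B : Matrix (Fin n ⊕ Unit) (Fin n) ℝ :=
      Matrix.fromRows 1 (Matrix.of fun (_ : Unit) (_ : Fin n) => (1 : ℝ))
    let C : Matrix (Fin n) (Fin n ⊕ Unit) ℝ :=
      Matrix.fromCols 1 (Matrix.of fun (i : Fin n) (_ : Unit) => s i * a i)
    refine ⟨B * C, fun i j => ?_, (rank_mul_le_left B C).trans ((rank_le_card_width B).trans
      (by simp))⟩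
    have hBC : B * C = Matrix.fromBlocks 1 (Matrix.of fun i _ => s i * a i)
        (Matrix.of fun _ _ => (1 : ℝ)) 0 := by
      simp only [B, C, fromRows_mul_fromCols, Matrix.one_mul, Matrix.mul_one]
      congr 1
      ext u u'
      simp only [mul_apply, of_apply, one_mul, Matrix.zero_apply]
      exact hsum
    rw [hBC]
    rcases i with i | ⟨⟩ <;> rcases j with j | ⟨⟩
    · simp only [fromBlocks_apply₁₁, partitionMatrix_inl_inl, one_apply]
      split_ifs <;> norm_num
    · simp only [fromBlocks_apply₁₂, of_apply, partitionMatrix_inl_inr, mul_pow, hs2, one_mul]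
    · simp only [fromBlocks_apply₂₁, of_apply, partitionMatrix_inr_inl, one_pow]
    · simp only [fromBlocks_apply₂₂, Matrix.zero_apply, partitionMatrix_inr_inr]
      norm_num

/-! ### Remark 5.7: the instance (5, 12, 13) -/

/-- **FGPRT Remark 5.7, first half** (p15): "This instance of the partition problem [`5, 12, 13`] is not
satisfiable" — so by Theorem 5.6 the `4 × 4` matrix `A = [[1,0,0,25],[0,1,0,144],[0,0,1,169],[1,1,1,0]]`
has no Hadamard square root of rank `≤ 3`: `rank_√(A) = 4`. [cite: FawziEtAl2015, Remark 5.7 (p15)] -/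
theorem not_hasHadamardSqrtOfRankLE_partitionMatrix_5_12_13 :
    ¬ HasHadamardSqrtOfRankLE (partitionMatrix ![5, 12, 13]) 3 := by
  rw [hasHadamardSqrtOfRankLE_partitionMatrix_iff]
  rintro ⟨s, hs, hsum⟩
  rw [Fin.sum_univ_three] at hsum
  simp only [Matrix.cons_val_zero, Matrix.cons_val_one, Matrix.cons_val] at hsum
  rcases hs 0 with h0 | h0 <;> rcases hs 1 with h1 | h1 <;> rcases hs 2 with h2 | h2 <;>
    rw [h0, h1, h2] at hsum <;> norm_num at hsum

/-- **FGPRT Remark 5.7, second half** (p15): "yet the matrix `A` has a `3 × 3` psd factorization",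
with the printed factors — the standard basis factorization `e_ie_iᵀ` of the identity on the first
three rows and columns, `[[1,0,−5/13],[0,1,−12/13],[−5/13,−12/13,1]]` (`= WᵀW`) on the fourth row and
`(5,12,13)(5,12,13)ᵀ` on the fourth column. Hence `rank_psd(A) ≤ 3 < 4 = rank_√(A)`.
[cite: FawziEtAl2015, Remark 5.7 (p15)] -/
theorem hasPsdFactorization_partitionMatrix_5_12_13 :
    HasPsdFactorization (fun i j => partitionMatrix ![5, 12, 13] i j) 3 := by
  let v : Fin 3 → ℝ := ![5, 12, 13]
  let W : Matrix (Fin 2) (Fin 3) ℝ := !![1, 0, -5/13; 0, 1, -12/13]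
  let A : Fin 3 ⊕ Unit → Matrix (Fin 3) (Fin 3) ℝ :=
    Sum.elim (fun i => vecMulVec (Pi.single i 1) (Pi.single i 1)) (fun _ => Wᵀ * W)
  let B : Fin 3 ⊕ Unit → Matrix (Fin 3) (Fin 3) ℝ :=
    Sum.elim (fun j => vecMulVec (Pi.single j 1) (Pi.single j 1)) (fun _ => vecMulVec v v)
  refine ⟨A, B, ?_, ?_, ?_⟩
  · rintro (i | ⟨⟩)
    · simp only [A, Sum.elim_inl]
      simpa using posSemidef_vecMulVec_self_star (Pi.single i (1 : ℝ))
    · simp only [A, Sum.elim_inr]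
      simpa using posSemidef_conjTranspose_mul_self W
  · rintro (j | ⟨⟩)
    · simp only [B, Sum.elim_inl]
      simpa using posSemidef_vecMulVec_self_star (Pi.single j (1 : ℝ))
    · simp only [B, Sum.elim_inr]
      simpa using posSemidef_vecMulVec_self_star v
  · rintro (i | ⟨⟩) (j | ⟨⟩)
    · show partitionMatrix _ _ _ = _
      rw [partitionMatrix_inl_inl]
      fin_cases i <;> fin_cases j <;>
        simp [A, B, trace, Matrix.mul_apply, vecMulVec_apply, Pi.single_apply]
    · show partitionMatrix _ _ _ = _
      rw [partitionMatrix_inl_inr]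
      fin_cases i <;>
        simp [A, B, v, trace, Matrix.mul_apply, vecMulVec_apply, Pi.single_apply] <;>
        norm_num
    · show partitionMatrix _ _ _ = _
      rw [partitionMatrix_inr_inl]
      fin_cases j <;>
        simp [A, B, W, trace, Matrix.mul_apply, vecMulVec_apply, Pi.single_apply, transpose_apply]
      norm_num
    · show partitionMatrix _ _ _ = _
      rw [partitionMatrix_inr_inr]
      simp [A, B, v, W, trace, Matrix.mul_apply, Fin.sum_univ_three, transpose_apply]
      norm_num


/-! ### Example 3.5: the square `[-1,1]²` -/

/-- The four vertices of the square `[-1,1]²`, ordered `(−1,−1), (1,−1), (1,1), (−1,1)` so that the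
slack matrix against `squareNormals` is FGPRT's `M` of eq. (4). [cite: FawziEtAl2015, Example 3.5 (p10)] -/
def squareVertices : Fin 4 → (Fin 2 → ℝ) := ![![-1, -1], ![1, -1], ![1, 1], ![-1, 1]]

/-- The four facet inequalities of `[-1,1]²`, normalised as `(1 − x)/2 ≥ 0`, `(1 − y)/2 ≥ 0`,
`(1 + x)/2 ≥ 0`, `(1 + y)/2 ≥ 0` (normals `a_j`, right-hand sides `1/2`) so that the slacks are `0/1`
as in eq. (4). [cite: FawziEtAl2015, Example 3.5 (p10)] -/
def squareNormals : Fin 4 → (Fin 2 → ℝ) := ![![1/2, 0], ![0, 1/2], ![-1/2, 0], ![0, -1/2]]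

/-- FGPRT's slack matrix of the square, eq. (4) (p10), verbatim:
`M = [[1,1,0,0],[0,1,1,0],[0,0,1,1],[1,0,0,1]]`. [cite: FawziEtAl2015, Example 3.5 eq. (4) (p10)] -/
def squareSlackMatrix : Matrix (Fin 4) (Fin 4) ℝ := !![1, 1, 0, 0; 0, 1, 1, 0; 0, 0, 1, 1; 1, 0, 0, 1]

/-- `M` "can be shown to be equal to" the slack matrix `S_P` of the two descriptions of the square.
[cite: FawziEtAl2015, Example 3.5 (p10)] -/
theorem squareSlackMatrix_eq_pairSlackMatrix :
    squareSlackMatrix = pairSlackMatrix squareVertices squareNormals (fun _ => 1 / 2) := by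
  funext i j
  fin_cases i <;> fin_cases j <;>
    simp [squareSlackMatrix, pairSlackMatrix, squareVertices, squareNormals, dotProduct,
      Fin.sum_univ_two] <;> norm_num

/-- The two descriptions agree: `conv{(±1,±1)} = {y : a_jᵀy ≤ 1/2 ∀ j} = [-1,1]²` (bilinear weights
`(1 ± y₁)(1 ± y₂)/4`). [cite: FawziEtAl2015, Example 3.5 (p10, "`P = Q = [-1,1]²` … 4 facets and 4
vertices")] -/
theorem convexHull_squareVertices :
    convexHull ℝ (Set.range squareVertices) = {y | ∀ j, squareNormals j ⬝ᵥ y ≤ 1 / 2} := by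
  apply Set.Subset.antisymm
  · refine convexHull_min ?_ ?_
    · rintro _ ⟨i, rfl⟩ j
      fin_cases i <;> fin_cases j <;>
        simp [squareVertices, squareNormals, dotProduct, Fin.sum_univ_two] <;> norm_num
    · rw [show {y : Fin 2 → ℝ | ∀ j, squareNormals j ⬝ᵥ y ≤ 1 / 2} =
          ⋂ j, {y | squareNormals j ⬝ᵥ y ≤ 1 / 2} from Set.ext fun y => by simp]
      exact convex_iInter fun j => convex_halfSpace_le
        ⟨fun y z => dotProduct_add _ y z, fun c y => dotProduct_smul c _ y⟩ _
  · intro y hy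
    have h0 := hy 0
    have h1 := hy 1
    have h2 := hy 2
    have h3 := hy 3
    simp only [squareNormals, dotProduct, Fin.sum_univ_two, Matrix.cons_val_zero, Matrix.cons_val_one,
      Matrix.cons_val] at h0 h1 h2 h3
    -- bilinear weights
    let w : Fin 4 → ℝ := ![(1 - y 0) * (1 - y 1) / 4, (1 + y 0) * (1 - y 1) / 4,
      (1 + y 0) * (1 + y 1) / 4, (1 - y 0) * (1 + y 1) / 4]
    have hw0 : ∀ i, 0 ≤ w i := by
      intro i
      fin_cases i <;> simp [w] <;> nlinarith
    have hw1 : ∑ i, w i = 1 := by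
      simp [w, Fin.sum_univ_four]
      ring
    have hy' : y = ∑ i, w i • squareVertices i := by
      funext t
      fin_cases t <;> simp [w, squareVertices, Fin.sum_univ_four] <;> ring
    rw [hy']
    exact (convex_convexHull ℝ _).sum_mem (fun i _ => hw0 i) hw1
      fun i _ => subset_convexHull ℝ _ (Set.mem_range_self i)

/-- The square is full-dimensional: its vertices affinely span `ℝ²`. [cite: FawziEtAl2015, Example 3.5
(p10, "`2+1 = 3`")] -/
theorem vectorSpan_squareVertices : vectorSpan ℝ (Set.range squareVertices) = ⊤ := by
  refine eq_top_iff.mpr fun y _ => ?_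
  have h10 : squareVertices 1 -ᵥ squareVertices 0 ∈ vectorSpan ℝ (Set.range squareVertices) :=
    vsub_mem_vectorSpan ℝ (Set.mem_range_self 1) (Set.mem_range_self 0)
  have h30 : squareVertices 3 -ᵥ squareVertices 0 ∈ vectorSpan ℝ (Set.range squareVertices) :=
    vsub_mem_vectorSpan ℝ (Set.mem_range_self 3) (Set.mem_range_self 0)
  have hy : y = (y 0 / 2) • (squareVertices 1 -ᵥ squareVertices 0) +
      (y 1 / 2) • (squareVertices 3 -ᵥ squareVertices 0) := by
    funext t
    fin_cases t <;> simp [squareVertices] <;> ring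
  rw [hy]
  exact Submodule.add_mem _ (Submodule.smul_mem _ _ h10) (Submodule.smul_mem _ _ h30)

/-- `dim P = 2`. [cite: FawziEtAl2015, Example 3.5 (p10)] -/
theorem finrank_vectorSpan_squareVertices :
    Module.finrank ℝ (vectorSpan ℝ (Set.range squareVertices)) = 2 := by
  rw [vectorSpan_squareVertices, finrank_top, Module.finrank_fin_fun]

/-- **The printed size-3 psd factorization of `M`**: `M_{ij} = ⟨u_iu_iᵀ, v_jv_jᵀ⟩` with `u =
(1,0,0),(0,1,0),(0,0,1),(1,1,1)` and `v = (1,0,0),(1,−1,0),(0,1,−1),(0,0,1)`; "`rank_psd M ≤ 3`".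
[cite: FawziEtAl2015, Example 3.5 (p10)] -/
theorem hasPsdFactorization_squareSlackMatrix_three : HasPsdFactorization squareSlackMatrix 3 := by
  let u : Fin 4 → (Fin 3 → ℝ) := ![![1, 0, 0], ![0, 1, 0], ![0, 0, 1], ![1, 1, 1]]
  let v : Fin 4 → (Fin 3 → ℝ) := ![![1, 0, 0], ![1, -1, 0], ![0, 1, -1], ![0, 0, 1]]
  refine ⟨fun i => vecMulVec (u i) (u i), fun j => vecMulVec (v j) (v j), fun i => ?_, fun j => ?_,
    fun i j => ?_⟩
  · simpa using posSemidef_vecMulVec_self_star (u i)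
  · simpa using posSemidef_vecMulVec_self_star (v j)
  · fin_cases i <;> fin_cases j <;>
      simp [squareSlackMatrix, u, v, trace, Matrix.mul_apply, Fin.sum_univ_three]

/-- **Example 3.5's conclusion**: `rank M = 3`, `rank_psd M > 2` ("no smaller representation of the
square is possible: … the psd rank of any `n`-dimensional polytope is at least `n+1`", the tree's
`FawziEtAl2015_cor59_holds`), and `rank_psd M ≤ 3`. [cite: FawziEtAl2015, Example 3.5 (p10)] -/
theorem squareSlackMatrix_rank_and_psdRank :
    squareSlackMatrix.rank = 3 ∧ ¬ HasPsdFactorization squareSlackMatrix 2 ∧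
      HasPsdFactorization squareSlackMatrix 3 := by
  have h := FawziEtAl2015_cor59_holds 2 4 4 2 squareVertices squareNormals (fun _ => 1 / 2) (by norm_num)
    finrank_vectorSpan_squareVertices convexHull_squareVertices
  have hfun : (fun i j => (1 / 2 : ℝ) - squareNormals j ⬝ᵥ squareVertices i) = squareSlackMatrix := by
    rw [squareSlackMatrix_eq_pairSlackMatrix]; rfl
  have hof : (Matrix.of fun i j => (1 / 2 : ℝ) - squareNormals j ⬝ᵥ squareVertices i) = squareSlackMatrix :=
    hfun
  rw [hof, hfun] at h
  exact ⟨h.1, h.2 2 le_rfl, hasPsdFactorization_squareSlackMatrix_three⟩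

/-- "Thus by Theorem 3.3 … one can represent the polytope `P = [-1,1]²` as the linear image of a
spectrahedron of size 3" (the text then exhibits the elliptope): `HasPsdLift P 3`, here by the tree's
`FawziEtAl2015_thm33_holds`. [cite: FawziEtAl2015, Example 3.5 (p10)] -/
theorem hasPsdLift_square_three : HasPsdLift (convexHull ℝ (Set.range squareVertices)) 3 := by
  have h := FawziEtAl2015_thm33_holds 2 4 4 3 squareVertices squareNormals (fun _ => 1 / 2) (by norm_num)
    convexHull_squareVertices
  rw [← squareSlackMatrix_eq_pairSlackMatrix] at h
  exact h.mp hasPsdFactorization_squareSlackMatrix_three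

/-! ### The fields `ℚ(√p : p ∈ P)` -/

/-- The real field `ℚ(√p : p ∈ P)` generated by the square roots of the members of a finite set `P` of
naturals (FGPRT's `ℚ(√𝒫_k)`, p17), as an intermediate field of `ℝ/ℚ`. [cite: FawziEtAl2015, Example 5.18
(p17)] -/
def sqrtField (P : Finset ℕ) : IntermediateField ℚ ℝ :=
  IntermediateField.adjoin ℚ ((fun p : ℕ => Real.sqrt p) '' (P : Set ℕ))

/-- Generators: `√p ∈ ℚ(√P)` for `p ∈ P`. [cite: FawziEtAl2015, Example 5.18 (p17)] -/
theorem sqrt_mem_sqrtField {P : Finset ℕ} {p : ℕ} (hp : p ∈ P) : Real.sqrt p ∈ sqrtField P :=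
  IntermediateField.subset_adjoin _ _ ⟨p, Finset.mem_coe.mpr hp, rfl⟩

/-- Monotonicity in `P`. [cite: FawziEtAl2015, Example 5.18 (p17)] -/
theorem sqrtField_mono {P P' : Finset ℕ} (h : P ⊆ P') : sqrtField P ≤ sqrtField P' :=
  IntermediateField.adjoin.mono _ _ _ (Set.image_mono (Finset.coe_subset.mpr h))

/-- Adjoining one more square root: every element of `ℚ(√P, √p)` is `a + b√p` with `a, b ∈ ℚ(√P)` (the
set of such elements is already a field, because `(√p)² ∈ ℚ`). [cite: Besicovitch1940, §1 (the tower
`ℚ(√p₁,…,√p_s)`); FawziEtAl2015, Example 5.18 (p17)] -/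
theorem exists_add_mul_sqrt_of_mem_sqrtField_insert {P : Finset ℕ} {p : ℕ} {x : ℝ}
    (hx : x ∈ sqrtField (insert p P)) :
    ∃ a ∈ sqrtField P, ∃ b ∈ sqrtField P, x = a + b * Real.sqrt p := by
  classical
  set E := sqrtField P with hE
  set s := Real.sqrt p with hs
  have hss : s * s = p := Real.mul_self_sqrt (Nat.cast_nonneg p)
  have hpE : (p : ℝ) ∈ E := natCast_mem E p
  let T : IntermediateField ℚ ℝ :=
    { carrier := {x | ∃ a ∈ E, ∃ b ∈ E, x = a + b * s}
      mul_mem' := by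
        rintro _ _ ⟨a, ha, b, hb, rfl⟩ ⟨c, hc, d, hd, rfl⟩
        refine ⟨a * c + b * d * p, add_mem (mul_mem ha hc) (mul_mem (mul_mem hb hd) hpE),
          a * d + b * c, add_mem (mul_mem ha hd) (mul_mem hb hc), ?_⟩
        have : (a + b * s) * (c + d * s) = a * c + b * d * (s * s) + (a * d + b * c) * s := by ring
        rw [this, hss]
      one_mem' := ⟨1, one_mem E, 0, zero_mem E, by ring⟩
      add_mem' := by
        rintro _ _ ⟨a, ha, b, hb, rfl⟩ ⟨c, hc, d, hd, rfl⟩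
        exact ⟨a + c, add_mem ha hc, b + d, add_mem hb hd, by ring⟩
      zero_mem' := ⟨0, zero_mem E, 0, zero_mem E, by ring⟩
      algebraMap_mem' := fun q => ⟨algebraMap ℚ ℝ q, algebraMap_mem E q, 0, zero_mem E, by ring⟩
      inv_mem' := by
        rintro _ ⟨a, ha, b, hb, rfl⟩
        by_cases hD : a * a - b * b * p = 0
        · have hfac : (a + b * s) * (a - b * s) = 0 := by
            have : (a + b * s) * (a - b * s) = a * a - b * b * (s * s) := by ring
            rw [this, hss, hD]
          rcases mul_eq_zero.mp hfac with h | h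
          · exact ⟨0, zero_mem E, 0, zero_mem E, by rw [h]; simp⟩
          · by_cases hb0 : b = 0
            · have ha0 : a = 0 := by simpa [hb0] using h
              exact ⟨0, zero_mem E, 0, zero_mem E, by simp [ha0, hb0]⟩
            · have hsE : s ∈ E := by
                have : s = a / b := by
                  field_simp
                  linarith [h]
                rw [this]
                exact div_mem ha hb
              exact ⟨(a + b * s)⁻¹, inv_mem (add_mem ha (mul_mem hb hsE)), 0, zero_mem E, by ring⟩
        · have hx : a + b * s ≠ 0 := by
            intro h0
            apply hD
            have : a * a - b * b * p = (a + b * s) * (a - b * s) := by rw [← hss]; ring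
            rw [this, h0, zero_mul]
          have hDE : a * a - b * b * p ∈ E := sub_mem (mul_mem ha ha) (mul_mem (mul_mem hb hb) hpE)
          refine ⟨a / (a * a - b * b * p), div_mem ha hDE, -b / (a * a - b * b * p),
            div_mem (neg_mem hb) hDE, ?_⟩
          have hprod : a * a - b * b * (p : ℝ) = (a + b * s) * (a - b * s) := by rw [← hss]; ring
          have hy : a - b * s ≠ 0 := fun h0 => hD (by rw [hprod, h0, mul_zero])
          rw [hprod]
          field_simp
          ring }
  have hle : sqrtField (insert p P) ≤ T := by
    rw [sqrtField, IntermediateField.adjoin_le_iff]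
    rintro _ ⟨q, hq, rfl⟩
    rw [Finset.coe_insert, Set.mem_insert_iff] at hq
    rcases hq with rfl | hq
    · exact ⟨0, zero_mem E, 1, one_mem E, by simp [hs]⟩
    · exact ⟨Real.sqrt q, sqrt_mem_sqrtField (Finset.mem_coe.mp hq), 0, zero_mem E, by simp⟩
  exact hle hx

/-- Squarefree naturals `> 1` are not squares. [folklore] -/
private theorem not_isSquare_of_squarefree {m : ℕ} (hsq : Squarefree m) (hm : 1 < m) : ¬ IsSquare m := by
  rintro ⟨r, rfl⟩
  have hr : IsUnit r := hsq r (dvd_refl _)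
  rw [Nat.isUnit_iff] at hr
  subst hr
  norm_num at hm

/-- **Square roots of new primes are not in `ℚ(√P)`** — the special case of Besicovitch's theorem (the
`2^k` products `√(∏_{p∈S} p)`, `S ⊆ P`, are linearly independent over `ℚ`) that FGPRT's Example 5.18
uses implicitly ("our square root of `Q^k` must have `x = ±√(2n_k−1)`" `∉ ℚ(√𝒫_k)`): for a finite set
`P` of primes and a squarefree `m > 1` none of whose prime factors lies in `P`, `√m ∉ ℚ(√p : p ∈ P)`.
Proof by induction on `P` (with `m` universally quantified): writing `√m = a + b√p` over `ℚ(√P)`,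
`b = 0` puts `√m` in `ℚ(√P)`, `a = 0` puts `√(mp)` there, and `ab ≠ 0` puts `√p` there.
[cite: Besicovitch1940, Thm. 2 (special case); FawziEtAl2015, Example 5.18 (p17)] -/
theorem sqrt_not_mem_sqrtField (P : Finset ℕ) (hP : ∀ p ∈ P, p.Prime) (m : ℕ) (hsq : Squarefree m)
    (hm : 1 < m) (hdis : ∀ q : ℕ, q.Prime → q ∣ m → q ∉ P) : Real.sqrt m ∉ sqrtField P := by
  classical
  induction P using Finset.induction_on generalizing m with
  | empty =>
    intro hmem
    rw [sqrtField, Finset.coe_empty, Set.image_empty, IntermediateField.adjoin_empty,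
      IntermediateField.mem_bot] at hmem
    have hirr : Irrational (Real.sqrt m) := irrational_sqrt_natCast_iff.mpr (not_isSquare_of_squarefree hsq hm)
    exact hirr (by simpa using hmem)
  | insert p P hpP ih =>
    intro hmem
    have hp : p.Prime := hP p (Finset.mem_insert_self _ _)
    have hP' : ∀ q ∈ P, q.Prime := fun q hq => hP q (Finset.mem_insert_of_mem hq)
    have hpm : ¬ p ∣ m := fun h => hdis p hp h (Finset.mem_insert_self _ _)
    have hdis' : ∀ q : ℕ, q.Prime → q ∣ m → q ∉ P := fun q hq hqm hqP =>
      hdis q hq hqm (Finset.mem_insert_of_mem hqP)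
    obtain ⟨a, ha, b, hb, hab⟩ := exists_add_mul_sqrt_of_mem_sqrtField_insert hmem
    set s := Real.sqrt p with hs
    have hss : s * s = p := Real.mul_self_sqrt (Nat.cast_nonneg p)
    have hmm : Real.sqrt m * Real.sqrt m = m := Real.mul_self_sqrt (Nat.cast_nonneg m)
    have hsq_eq : (m : ℝ) = a * a + b * b * p + 2 * a * b * s := by
      rw [← hmm, hab]
      have : (a + b * s) * (a + b * s) = a * a + b * b * (s * s) + 2 * a * b * s := by ring
      rw [this, hss]
    by_cases hb0 : b = 0
    · -- `√m = a ∈ ℚ(√P)`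
      apply ih hP' m hsq hm hdis'
      rw [hab, hb0, zero_mul, add_zero]
      exact ha
    by_cases ha0 : a = 0
    · -- `√m = b√p`, so `√(mp) = bp ∈ ℚ(√P)`
      have hcop : m.Coprime p := (Nat.coprime_comm).mp ((Nat.Prime.coprime_iff_not_dvd hp).mpr hpm)
      apply ih hP' (m * p) (Nat.squarefree_mul_iff.mpr ⟨hcop, hsq, hp.squarefree⟩)
        (one_lt_mul'' hm hp.one_lt)
      · intro q hq hqmp hqP
        rcases (Nat.Prime.dvd_mul hq).mp hqmp with h | h
        · exact hdis' q hq h hqP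
        · have : q = p := (Nat.prime_dvd_prime_iff_eq hq hp).mp h
          exact hpP (this ▸ hqP)
      · have : Real.sqrt ((m * p : ℕ) : ℝ) = b * p := by
          rw [Nat.cast_mul, Real.sqrt_mul (Nat.cast_nonneg m), hab, ha0, zero_add, ← hs, mul_assoc, hss]
        rw [this]
        exact mul_mem hb (natCast_mem _ p)
    · -- `a, b ≠ 0`: `√p = (m − a² − b²p)/(2ab) ∈ ℚ(√P)`
      have hsp : s = ((m : ℝ) - a * a - b * b * p) / (2 * a * b) := by
        field_simp
        linarith [hsq_eq]
      apply ih hP' p hp.squarefree hp.one_lt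
      · intro q hq hqp hqP
        have : q = p := (Nat.prime_dvd_prime_iff_eq hq hp).mp hqp
        exact hpP (this ▸ hqP)
      · rw [← hs, hsp]
        refine div_mem (sub_mem (sub_mem (natCast_mem _ m) (mul_mem ha ha))
          (mul_mem (mul_mem hb hb) (natCast_mem _ p))) (mul_mem (mul_mem ?_ ha) hb)
        exact_mod_cast natCast_mem (sqrtField P) 2

/-- `√t ∈ ℚ(√q : q prime, q < N)` for every natural `t < N` (factor `t` into primes `< N`): the entries
`±√(n_i + n_j − 1)`, `(i,j) ≠ (k,k)`, of a square root of `Q^k` lie in `ℚ(√𝒫_k)`.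
[cite: FawziEtAl2015, Example 5.18 (p17)] -/
theorem sqrt_mem_sqrtField_primesBelow {N : ℕ} :
    ∀ t : ℕ, t < N → Real.sqrt t ∈ sqrtField ((Finset.range N).filter Nat.Prime) := by
  intro t
  induction t using Nat.strong_induction_on with
  | _ t ih =>
    intro ht
    rcases Nat.lt_or_ge t 2 with h2 | h2
    · interval_cases t
      · simp only [Nat.cast_zero, Real.sqrt_zero]; exact zero_mem _
      · simp only [Nat.cast_one, Real.sqrt_one]; exact one_mem _
    · obtain ⟨r, hr, u, rfl⟩ := Nat.exists_prime_and_dvd (show t ≠ 1 by omega)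
      have hu0 : 0 < u := Nat.pos_of_ne_zero fun h => by subst h; simp at h2
      have hru : r ≤ r * u := Nat.le_mul_of_pos_right r hu0
      have hult : u < r * u := lt_mul_of_one_lt_left hu0 hr.one_lt
      rw [Nat.cast_mul, Real.sqrt_mul (Nat.cast_nonneg r)]
      refine mul_mem (sqrt_mem_sqrtField ?_) (ih u hult (lt_of_lt_of_le hult (le_of_lt ht)) )
      exact Finset.mem_filter.mpr ⟨Finset.mem_range.mpr (lt_of_le_of_lt hru ht), hr⟩

/-! ### Example 5.18: prime matrices -/

/-- **FGPRT's prime matrices** (Example 5.18, p17): `Q^k_{ij} = n_i + n_j − 1` for a sequence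
`n : Fin k → ℕ` (in the text increasing with every `2n_i − 1` prime, so that the diagonal lists primes).
[cite: FawziEtAl2015, Example 5.18 (p17)] -/
def primeMatrix {k : ℕ} (n : Fin k → ℕ) : Matrix (Fin k) (Fin k) ℝ :=
  Matrix.of fun i j => ((n i + n j - 1 : ℕ) : ℝ)

/-- Entries of `primeMatrix`. [cite: FawziEtAl2015, Example 5.18 (p17)] -/
@[simp] theorem primeMatrix_apply {k : ℕ} (n : Fin k → ℕ) (i j : Fin k) :
    primeMatrix n i j = ((n i + n j - 1 : ℕ) : ℝ) := rfl

/-- Real square roots of a natural number are `±√t`. [folklore] -/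
private theorem eq_sqrt_or_eq_neg_sqrt {x : ℝ} {t : ℕ} (h : x ^ 2 = (t : ℝ)) :
    x = Real.sqrt t ∨ x = -Real.sqrt t :=
  sq_eq_sq_iff_eq_or_eq_neg.mp (by rw [h, Real.sq_sqrt (Nat.cast_nonneg t)])

/-- A determinant of entries from a subfield lies in the subfield ("`α` and `β` are in the extension
field `ℚ(√𝒫_k)`"). [cite: FawziEtAl2015, Example 5.18 (p17)] -/
private theorem det_mem_of_forall_mem {m : Type*} [Fintype m] [DecidableEq m] (K : IntermediateField ℚ ℝ)
    (A : Matrix m m ℝ) (hA : ∀ i j, A i j ∈ K) : A.det ∈ K := by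
  let B : Matrix m m K := fun i j => ⟨A i j, hA i j⟩
  have hB : A = (algebraMap K ℝ).mapMatrix B := by
    ext i j; rfl
  rw [hB, ← RingHom.map_det]
  exact SetLike.coe_mem _

/-- **Example 5.18, the induction** (p17): for `n` strictly increasing with all `2n_i − 1` prime, EVERY
Hadamard square root `N` (`N_{ij}² = n_i + n_j − 1`) of `Q^k` is nonsingular. Printed argument: expand
`det N` along the last row as `αx + β`, `x = N_{kk} = ±√(2n_k − 1)`, where `α = det` of the leading
block (a square root of `Q^{k−1}`, nonzero by induction) and `α, β ∈ ℚ(√𝒫_k)` (all other entries are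
`±√t` with `t < 2n_k − 1`); `det N = 0` would give `x = −β/α ∈ ℚ(√𝒫_k)`, contradicting
`sqrt_not_mem_sqrtField`. [cite: FawziEtAl2015, Example 5.18 (p17)] -/
theorem det_ne_zero_of_sq_eq_primeMatrix : ∀ (k : ℕ) (n : Fin k → ℕ), StrictMono n →
    (∀ i, (2 * n i - 1).Prime) → ∀ N : Matrix (Fin k) (Fin k) ℝ,
      (∀ i j, N i j ^ 2 = primeMatrix n i j) → N.det ≠ 0 := by
  intro k
  induction k with
  | zero => intro n _ _ N _; simp [Matrix.det_isEmpty]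
  | succ k ih =>
    intro n hn hprime N hN
    -- the leading block is a square root of the smaller prime matrix
    have hN' : ∀ i j, (N.submatrix Fin.castSucc Fin.castSucc) i j ^ 2 =
        primeMatrix (n ∘ Fin.castSucc) i j := fun i j => hN _ _
    have hα := ih (n ∘ Fin.castSucc) (hn.comp Fin.strictMono_castSucc) (fun i => hprime _) _ hN'
    -- the field `K = ℚ(√q' : q' prime, q' < q)`, `q = 2 n_last − 1`
    set q : ℕ := 2 * n (Fin.last k) - 1 with hq
    have hqp : q.Prime := hprime (Fin.last k)
    set K := sqrtField ((Finset.range q).filter Nat.Prime) with hK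
    have hn1 : ∀ i, 1 ≤ n i := by
      intro i
      by_contra h
      have h0 : n i = 0 := by omega
      have := hprime i
      rw [h0] at this
      exact Nat.not_prime_zero (by simpa using this)
    -- all entries except the corner lie in `K`
    have hmem : ∀ i j, ¬ (i = Fin.last k ∧ j = Fin.last k) → N i j ∈ K := by
      intro i j hij
      have hlt : n i + n j - 1 < q := by
        have hi : n i ≤ n (Fin.last k) := hn.monotone (Fin.le_last i)
        have hj : n j ≤ n (Fin.last k) := hn.monotone (Fin.le_last j)
        have : n i < n (Fin.last k) ∨ n j < n (Fin.last k) := by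
          by_contra h
          push Not at h
          have hi' : i = Fin.last k := hn.injective (le_antisymm hi h.1)
          have hj' : j = Fin.last k := hn.injective (le_antisymm hj h.2)
          exact hij ⟨hi', hj'⟩
        have h1 := hn1 i
        omega
      rcases eq_sqrt_or_eq_neg_sqrt (hN i j) with h | h
      · rw [h]; exact sqrt_mem_sqrtField_primesBelow _ hlt
      · rw [h]; exact neg_mem (sqrt_mem_sqrtField_primesBelow _ hlt)
    -- Laplace expansion along the last row: `det N = x · α + β` with `α, β ∈ K`
    have hαK : (N.submatrix Fin.castSucc Fin.castSucc).det ∈ K :=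
      det_mem_of_forall_mem K _ fun i j => hmem _ _ fun h => (Fin.castSucc_lt_last i).ne h.1
    set β : ℝ := ∑ j : Fin k, (-1) ^ ((Fin.last k : ℕ) + (Fin.castSucc j : ℕ)) *
        N (Fin.last k) (Fin.castSucc j) *
        (N.submatrix Fin.castSucc (Fin.castSucc j).succAbove).det with hβ
    have hβK : β ∈ K := by
      refine sum_mem fun j _ => mul_mem (mul_mem ?_ (hmem _ _ fun h =>
        (Fin.castSucc_lt_last j).ne h.2)) (det_mem_of_forall_mem K _ fun i l => hmem _ _ fun h =>
        (Fin.castSucc_lt_last i).ne h.1)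
      exact pow_mem (neg_mem (one_mem K)) _
    have hdet : N.det = N (Fin.last k) (Fin.last k) * (N.submatrix Fin.castSucc Fin.castSucc).det + β := by
      rw [det_succ_row N (Fin.last k), Fin.sum_univ_castSucc, Fin.succAbove_last, hβ, add_comm]
      congr 1
      have : (-1 : ℝ) ^ ((Fin.last k : ℕ) + (Fin.last k : ℕ)) = 1 := by
        rw [← two_mul, pow_mul, neg_one_sq, one_pow]
      rw [this, one_mul]
    -- conclusion
    intro hdet0
    set x := N (Fin.last k) (Fin.last k) with hx
    have hxK : x ∈ K := by
      have : x = -β / (N.submatrix Fin.castSucc Fin.castSucc).det := by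
        rw [eq_div_iff hα]
        linarith [hdet.symm.trans hdet0]
      rw [this]
      exact div_mem (neg_mem hβK) hαK
    have hx2 : x ^ 2 = (q : ℝ) := by
      rw [hx, hN, primeMatrix_apply, hq, two_mul]
    have hsqK : Real.sqrt q ∈ K := by
      rcases eq_sqrt_or_eq_neg_sqrt hx2 with h | h
      · rw [← h]; exact hxK
      · have : Real.sqrt q = -x := by rw [h, neg_neg]
        rw [this]; exact neg_mem hxK
    refine sqrt_not_mem_sqrtField _ (fun p hp => (Finset.mem_filter.mp hp).2) q hqp.squarefree
      hqp.one_lt (fun r hr hrq hrP => ?_) hsqK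
    have : r = q := (Nat.prime_dvd_prime_iff_eq hr hqp).mp hrq
    have hlt := Finset.mem_range.mp (Finset.mem_filter.mp hrP).1
    omega

/-- **Example 5.18** (p17): "`Q^k` has full square root rank for each `k`" — every Hadamard square
root has rank `k`, so `rank_√(Q^k) ≤ r` forces `k ≤ r`. With `primeMatrix_rank_le_two` this is the
Table 1 witness that `rank_√` can be arbitrarily larger than rank, nonnegative rank and psd rank.
[cite: FawziEtAl2015, Example 5.18 (p17)] -/
theorem le_of_hasHadamardSqrtOfRankLE_primeMatrix {k : ℕ} (n : Fin k → ℕ) (hn : StrictMono n)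
    (hprime : ∀ i, (2 * n i - 1).Prime) {r : ℕ} (h : HasHadamardSqrtOfRankLE (primeMatrix n) r) :
    k ≤ r := by
  classical
  obtain ⟨N, hN, hr⟩ := h
  have hdet := det_ne_zero_of_sq_eq_primeMatrix k n hn hprime N hN
  have hrank : N.rank = k := by
    rw [rank_of_isUnit N ((isUnit_iff_isUnit_det _).mpr (isUnit_iff_ne_zero.mpr hdet)), Fintype.card_fin]
  omega

/-- **Example 5.18, the small ranks** (p17): "`Q^k` has usual rank two for all `k`. Consequently, by
Proposition 2.8, the nonnegative rank and psd rank of `Q^k` are also two" — here directly: for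
`n_i ≥ 1`, `Q^k_{ij} = (n_i − ½)·1 + 1·(n_j − ½)` is a nonnegative factorization of size `2`, whence
`rank ≤ 2` and a psd factorization of size `2` (`HasPsdFactorization.of_nonnegFactorization`).
[cite: FawziEtAl2015, Example 5.18 (p17)] -/
theorem primeMatrix_rank_le_two {k : ℕ} (n : Fin k → ℕ) (hn1 : ∀ i, 1 ≤ n i) :
    (primeMatrix n).rank ≤ 2 ∧
      (∃ (U : Fin k → Fin 2 → ℝ) (V : Fin 2 → Fin k → ℝ), (∀ i l, 0 ≤ U i l) ∧ (∀ l j, 0 ≤ V l j) ∧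
        ∀ i j, primeMatrix n i j = ∑ l, U i l * V l j) ∧
      HasPsdFactorization (primeMatrix n) 2 := by
  let U : Fin k → Fin 2 → ℝ := fun i l => if l = 0 then (n i : ℝ) - 1 / 2 else 1
  let V : Fin 2 → Fin k → ℝ := fun l j => if l = 0 then 1 else (n j : ℝ) - 1 / 2
  have hU : ∀ i l, 0 ≤ U i l := by
    intro i l
    simp only [U]
    split_ifs
    · have := hn1 i
      have : (1 : ℝ) ≤ n i := by exact_mod_cast this
      linarith
    · norm_num
  have hV : ∀ l j, 0 ≤ V l j := by
    intro l j
    simp only [V]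
    split_ifs
    · norm_num
    · have := hn1 j
      have : (1 : ℝ) ≤ n j := by exact_mod_cast this
      linarith
  have hM : ∀ i j, primeMatrix n i j = ∑ l, U i l * V l j := by
    intro i j
    rw [primeMatrix_apply, Nat.cast_sub (by have := hn1 i; omega), Nat.cast_add, Nat.cast_one,
      Fin.sum_univ_two]
    simp only [U, V, if_pos rfl, if_neg (show (1 : Fin 2) ≠ 0 by decide)]
    ring
  refine ⟨?_, ⟨U, V, hU, hV, hM⟩, HasPsdFactorization.of_nonnegFactorization U V hU hV hM⟩
  have hfac : primeMatrix n = (Matrix.of fun i l => U i l) * (Matrix.of fun l j => V l j) := by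
    ext i j
    rw [hM i j, Matrix.mul_apply]
    rfl
  rw [hfac]
  exact (rank_mul_le_left _ _).trans ((rank_le_card_width _).trans (by simp))

/-! ### Example 3.6: the rectangle `[-a,a] × [-b,b]` inside the square `[-1,1]²` -/

/-- The vertices `(∓a, ∓b)` of the rectangle `P = [-a,a] × [-b,b]`, ordered `(−a,−b), (a,−b), (a,b),
(−a,b)` so that the slack matrix against `unitSquareNormals` is FGPRT's `M` of eq. (5).
[cite: FawziEtAl2015, Example 3.6 (p10)] -/
def rectVertices (a b : ℝ) : Fin 4 → (Fin 2 → ℝ) := ![![-a, -b], ![a, -b], ![a, b], ![-a, b]]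

/-- The facets `y₁ ≤ 1`, `y₂ ≤ 1`, `−y₁ ≤ 1`, `−y₂ ≤ 1` of `Q = [-1,1]²` (normals, right-hand sides `1`).
[cite: FawziEtAl2015, Example 3.6 (p10)] -/
def unitSquareNormals : Fin 4 → (Fin 2 → ℝ) := ![![1, 0], ![0, 1], ![-1, 0], ![0, -1]]

/-- The slack matrix `S_{P,Q}` of the nested rectangles (Definition 3.1 applied to the two descriptions).
[cite: FawziEtAl2015, Example 3.6 eq. (5) (p10)] -/
def nestedRectanglesMatrix (a b : ℝ) : Fin 4 → Fin 4 → ℝ :=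
  pairSlackMatrix (rectVertices a b) unitSquareNormals (fun _ => 1)

/-- `S_{P,Q}` "can be easily computed and is given by" eq. (5), verbatim.
[cite: FawziEtAl2015, Example 3.6 eq. (5) (p10)] -/
theorem nestedRectanglesMatrix_eq (a b : ℝ) : nestedRectanglesMatrix a b =
    !![1 + a, 1 + b, 1 - a, 1 - b; 1 - a, 1 + b, 1 + a, 1 - b; 1 - a, 1 - b, 1 + a, 1 + b;
      1 + a, 1 - b, 1 - a, 1 + b] := by
  funext i j
  fin_cases i <;> fin_cases j <;>
    simp [nestedRectanglesMatrix, pairSlackMatrix, rectVertices, unitSquareNormals, dotProduct,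
      Fin.sum_univ_two]

/-- `Tr(A · wwᵀ) = wᵀ A w`. [folklore] -/
private theorem trace_mul_vecMulVec_self {n : Type*} [Fintype n] (A : Matrix n n ℝ) (w : n → ℝ) :
    (A * vecMulVec w w).trace = w ⬝ᵥ (A *ᵥ w) := by
  simp only [trace, diag_apply, mul_apply, vecMulVec_apply, dotProduct, mulVec, Finset.mul_sum]
  exact Finset.sum_congr rfl fun i _ => Finset.sum_congr rfl fun j _ => by ring

/-- The point `T(y) = [[1, y₁, y₂], [y₁, 1, y₁y₂], [y₂, y₁y₂, 1]]` of the elliptope above `y ∈ [-1,1]²`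
(Example 3.5's size-3 spectrahedron `T`, with `z = y₁y₂`). [cite: FawziEtAl2015, Example 3.5 (p10, the
elliptope `T`)] -/
private def momentMatrix (y : Fin 2 → ℝ) : Matrix (Fin 3) (Fin 3) ℝ :=
  !![1, y 0, y 1; y 0, 1, y 0 * y 1; y 1, y 0 * y 1, 1]

/-- `T(y)` is the mixture `Σ_{s,t=±1} ¼(1+sy₁)(1+ty₂) · (1,s,t)(1,s,t)ᵀ`. [folklore] -/
private theorem momentMatrix_eq_sum (y : Fin 2 → ℝ) : momentMatrix y =
    ∑ s : Fin 2, ∑ t : Fin 2,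
      ((1 + (if s = 0 then 1 else -1) * y 0) * (1 + (if t = 0 then 1 else -1) * y 1) / 4) •
        vecMulVec ![1, if s = 0 then 1 else -1, if t = 0 then 1 else -1]
          ![1, if s = 0 then 1 else -1, if t = 0 then 1 else -1] := by
  ext i j
  simp only [Fin.sum_univ_two, Fin.isValue, if_true, show (1 : Fin 2) ≠ 0 by decide, if_false,
    Matrix.add_apply, Matrix.smul_apply, vecMulVec_apply, smul_eq_mul]
  fin_cases i <;> fin_cases j <;> simp [momentMatrix] <;> ring

/-- `T(y) ⪰ 0` for `|y₁|, |y₂| ≤ 1`. [cite: FawziEtAl2015, Example 3.5 (p10)] -/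
private theorem posSemidef_momentMatrix {y : Fin 2 → ℝ} (h0 : |y 0| ≤ 1) (h1 : |y 1| ≤ 1) :
    (momentMatrix y).PosSemidef := by
  rw [momentMatrix_eq_sum]
  refine posSemidef_sum _ fun s _ => posSemidef_sum _ fun t _ => PosSemidef.smul ?_ ?_
  · simpa using posSemidef_vecMulVec_self_star
      (![1, if s = 0 then 1 else -1, if t = 0 then 1 else -1] : Fin 3 → ℝ)
  · have ha : 0 ≤ 1 + (if s = 0 then (1 : ℝ) else -1) * y 0 := by
      split_ifs <;> [linarith [(abs_le.mp h0).1]; linarith [(abs_le.mp h0).2]]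
    have hb : 0 ≤ 1 + (if t = 0 then (1 : ℝ) else -1) * y 1 := by
      split_ifs <;> [linarith [(abs_le.mp h1).1]; linarith [(abs_le.mp h1).2]]
    positivity

/-- **"`rank_psd M ≤ 3` for all `a, b ≤ 1`"** (here `0 ≤ a, b ≤ 1`): `M_{ij} = ⟨T(v_i), ½ w_jw_jᵀ⟩` with
`w_j = e₁ ∓ e₂, e₁ ∓ e₃` — the factorization induced by the square's size-3 lift (Theorem 3.3).
[cite: FawziEtAl2015, Example 3.6 (p10)] -/
theorem hasPsdFactorization_nestedRectangles_three {a b : ℝ} (ha : 0 ≤ a) (ha1 : a ≤ 1) (hb : 0 ≤ b)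
    (hb1 : b ≤ 1) : HasPsdFactorization (nestedRectanglesMatrix a b) 3 := by
  let w : Fin 4 → (Fin 3 → ℝ) := ![![1, -1, 0], ![1, 0, -1], ![1, 1, 0], ![1, 0, 1]]
  refine ⟨fun i => momentMatrix (rectVertices a b i), fun j => (1 / 2 : ℝ) • vecMulVec (w j) (w j),
    fun i => ?_, fun j => ?_, fun i j => ?_⟩
  · apply posSemidef_momentMatrix <;> fin_cases i <;>
      simp [rectVertices, abs_le] <;> constructor <;> linarith
  · have h := posSemidef_vecMulVec_self_star (w j)
    simp only [star_trivial] at h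
    exact h.smul (by norm_num)
  · rw [Matrix.mul_smul, trace_smul, smul_eq_mul, trace_mul_vecMulVec_self, nestedRectanglesMatrix_eq]
    fin_cases i <;> fin_cases j <;>
      simp [momentMatrix, rectVertices, w, dotProduct, mulVec, Fin.sum_univ_three] <;> ring

/-- The size-2 lift of the unit disk: `D(y) = [[1 + y₁, y₂], [y₂, 1 − y₁]]`. [cite: FawziEtAl2015,
Example 3.6 (p10, "an ellipse `E` such that `P ⊆ E ⊆ Q`")] -/
private def diskMatrix (y : Fin 2 → ℝ) : Matrix (Fin 2) (Fin 2) ℝ :=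
  !![1 + y 0, y 1; y 1, 1 - y 0]

/-- `D(y) ⪰ 0` on the unit disk. [folklore] -/
private theorem posSemidef_diskMatrix {y : Fin 2 → ℝ} (h : y 0 ^ 2 + y 1 ^ 2 ≤ 1) :
    (diskMatrix y).PosSemidef := by
  refine PosSemidef.of_dotProduct_mulVec_nonneg ?_ fun x => ?_
  · rw [IsHermitian, conjTranspose_eq_transpose_of_trivial]
    ext i j; fin_cases i <;> fin_cases j <;> rfl
  · simp only [star_trivial, diskMatrix, dotProduct, mulVec, Fin.sum_univ_two, of_apply, cons_val',
      cons_val_zero, cons_val_one, cons_val_fin_one, empty_val']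
    have key : (1 + y 0) * (x 0 * ((1 + y 0) * x 0 + y 1 * x 1) + x 1 * (y 1 * x 0 + (1 - y 0) * x 1)) =
        ((1 + y 0) * x 0 + y 1 * x 1) ^ 2 + (1 - y 0 ^ 2 - y 1 ^ 2) * x 1 ^ 2 := by ring
    by_cases h0 : 1 + y 0 = 0
    · have hy0 : y 0 = -1 := by linarith
      have hy1 : y 1 = 0 := by nlinarith
      rw [hy0, hy1]
      nlinarith [sq_nonneg (x 1)]
    · have hy0 : -1 ≤ y 0 := by nlinarith [sq_nonneg (y 1)]
      have hpos : 0 < 1 + y 0 := lt_of_le_of_ne (by linarith) (Ne.symm h0)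
      have hprod : 0 ≤ (1 + y 0) *
          (x 0 * ((1 + y 0) * x 0 + y 1 * x 1) + x 1 * (y 1 * x 0 + (1 - y 0) * x 1)) := by
        rw [key]
        nlinarith [sq_nonneg ((1 + y 0) * x 0 + y 1 * x 1), sq_nonneg (x 1)]
      exact (mul_nonneg_iff_of_pos_left hpos).mp hprod

/-- **Size 2 when `a² + b² ≤ 1`**: then `P ⊆` unit disk `⊆ Q`, and `M_{ij} = ⟨D(v_i), B_j⟩` with
`B_j ∈ {e₂e₂ᵀ, ½(e₁−e₂)(e₁−e₂)ᵀ, e₁e₁ᵀ, ½(e₁+e₂)(e₁+e₂)ᵀ}`. [cite: FawziEtAl2015, Example 3.6 (p10)] -/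
theorem hasPsdFactorization_nestedRectangles_two {a b : ℝ} (h : a ^ 2 + b ^ 2 ≤ 1) :
    HasPsdFactorization (nestedRectanglesMatrix a b) 2 := by
  let w : Fin 4 → (Fin 2 → ℝ) := ![![0, 1], ![1, -1], ![1, 0], ![1, 1]]
  let c : Fin 4 → ℝ := ![1, 1 / 2, 1, 1 / 2]
  refine ⟨fun i => diskMatrix (rectVertices a b i), fun j => c j • vecMulVec (w j) (w j),
    fun i => ?_, fun j => ?_, fun i j => ?_⟩
  · apply posSemidef_diskMatrix
    fin_cases i <;> simp [rectVertices] <;> nlinarith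
  · have h := posSemidef_vecMulVec_self_star (w j)
    simp only [star_trivial] at h
    exact h.smul (by fin_cases j <;> simp [c])
  · rw [Matrix.mul_smul, trace_smul, smul_eq_mul, trace_mul_vecMulVec_self, nestedRectanglesMatrix_eq]
    fin_cases i <;> fin_cases j <;>
      simp [diskMatrix, rectVertices, w, c, dotProduct, mulVec, Fin.sum_univ_two] <;> ring


/-- `Q = [-1,1]²` is bounded. [cite: FawziEtAl2015, Example 3.6 (p10)] -/
private theorem isBounded_unitSquare :
    Bornology.IsBounded {y : Fin 2 → ℝ | ∀ j, unitSquareNormals j ⬝ᵥ y ≤ 1} := by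
  refine (Metric.isBounded_closedBall (x := (0 : Fin 2 → ℝ)) (r := 1)).subset fun y hy => ?_
  have h0 := hy 0
  have h1 := hy 1
  have h2 := hy 2
  have h3 := hy 3
  simp [unitSquareNormals, dotProduct, Fin.sum_univ_two] at h0 h1 h2 h3
  rw [Metric.mem_closedBall, dist_zero_right, pi_norm_le_iff_of_nonneg zero_le_one]
  intro i
  rw [Real.norm_eq_abs, abs_le]
  fin_cases i <;> constructor <;> simp <;> linarith

/-- `P ⊆ Q` for `0 ≤ a, b ≤ 1`. [cite: FawziEtAl2015, Example 3.6 (p10)] -/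
private theorem rectVertices_mem {a b : ℝ} (ha : 0 ≤ a) (ha1 : a ≤ 1) (hb : 0 ≤ b) (hb1 : b ≤ 1) :
    ∀ i j, unitSquareNormals j ⬝ᵥ rectVertices a b i ≤ 1 := by
  intro i j
  fin_cases i <;> fin_cases j <;>
    simp [unitSquareNormals, rectVertices, dotProduct, Fin.sum_univ_two] <;> linarith

/-- `rank M = 3` when `a, b ≠ 0` (`M = BC` through `ℝ³`; the leading `3 × 3` minor is `8ab`).
[cite: FawziEtAl2015, Example 3.6 (p10) and §4 (p13, "Assume that `rank M = 3`")] -/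
private theorem rank_nestedRectangles {a b : ℝ} (ha : a ≠ 0) (hb : b ≠ 0) :
    (Matrix.of (pairSlackMatrix (rectVertices a b) unitSquareNormals fun _ => 1)).rank = 3 := by
  classical
  have hM : Matrix.of (pairSlackMatrix (rectVertices a b) unitSquareNormals fun _ => 1) =
      !![1 + a, 1 + b, 1 - a, 1 - b; 1 - a, 1 + b, 1 + a, 1 - b; 1 - a, 1 - b, 1 + a, 1 + b;
        1 + a, 1 - b, 1 - a, 1 + b] := by
    have := nestedRectanglesMatrix_eq a b
    unfold nestedRectanglesMatrix at this
    exact this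
  rw [hM]
  apply le_antisymm
  · -- `M = B C` with inner dimension `3`
    let B : Matrix (Fin 4) (Fin 3) ℝ := !![1, -a, -b; 1, a, -b; 1, a, b; 1, -a, b]
    let C : Matrix (Fin 3) (Fin 4) ℝ := !![1, 1, 1, 1; -1, 0, 1, 0; 0, -1, 0, 1]
    have hBC : !![1 + a, 1 + b, 1 - a, 1 - b; 1 - a, 1 + b, 1 + a, 1 - b; 1 - a, 1 - b, 1 + a, 1 + b;
        1 + a, 1 - b, 1 - a, 1 + b] = B * C := by
      ext i j
      fin_cases i <;> fin_cases j <;> simp [B, C, Matrix.mul_apply, Fin.sum_univ_three] <;> ring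
    rw [hBC]
    exact (rank_mul_le_left _ _).trans ((rank_le_card_width _).trans (by simp))
  · -- the leading `3 × 3` minor has determinant `8ab ≠ 0`
    let f : Fin 3 → Fin 4 := Fin.castSucc
    have hdet : ((!![1 + a, 1 + b, 1 - a, 1 - b; 1 - a, 1 + b, 1 + a, 1 - b;
        1 - a, 1 - b, 1 + a, 1 + b; 1 + a, 1 - b, 1 - a, 1 + b] : Matrix (Fin 4) (Fin 4) ℝ).submatrix
        f f).det = 8 * a * b := by
      rw [det_fin_three]
      simp [f, Fin.castSucc]
      ring
    have hunit : IsUnit ((!![1 + a, 1 + b, 1 - a, 1 - b; 1 - a, 1 + b, 1 + a, 1 - b;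
        1 - a, 1 - b, 1 + a, 1 + b; 1 + a, 1 - b, 1 - a, 1 + b] : Matrix (Fin 4) (Fin 4) ℝ).submatrix
        f f) := by
      rw [isUnit_iff_isUnit_det, hdet, isUnit_iff_ne_zero]
      positivity
    calc 3 = ((!![1 + a, 1 + b, 1 - a, 1 - b; 1 - a, 1 + b, 1 + a, 1 - b;
        1 - a, 1 - b, 1 + a, 1 + b; 1 + a, 1 - b, 1 - a, 1 + b] : Matrix (Fin 4) (Fin 4) ℝ).submatrix
        f f).rank := by rw [rank_of_isUnit _ hunit, Fintype.card_fin]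
      _ ≤ _ := rank_submatrix_le _ _ _

/-- **Size 2 forces `a² + b² ≤ 1`** (`0 ≤ a, b ≤ 1`; "It is not hard to see that such an ellipse exists
if and only if `a² + b² ≤ 1`"): for `a, b > 0` the §4 criterion (`FawziEtAl2015_sec4_ellipse_holds`)
turns a size-2 factorization into an ellipse `yᵀAy + 2cᵀy + γ ≤ 0` containing the vertices and
contained in `Q`; summing its quadratic over the four vertices gives `A₁₁a² + A₂₂b² + γ ≤ 0`, and testing
the points `(±t, 0)`, `(0, ±t)` with `A_{ii}t² + γ = 0` against `Q` gives `A₁₁, A₂₂ ≥ −γ`, whence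
`a² + b² ≤ 1`. (`a = 0` or `b = 0`: trivial.) [cite: FawziEtAl2015, Example 3.6 (p10); §4 (p13)] -/
theorem sq_add_sq_le_one_of_hasPsdFactorization_two {a b : ℝ} (ha : 0 ≤ a) (ha1 : a ≤ 1)
    (hb : 0 ≤ b) (hb1 : b ≤ 1) (h : HasPsdFactorization (nestedRectanglesMatrix a b) 2) :
    a ^ 2 + b ^ 2 ≤ 1 := by
  rcases eq_or_lt_of_le ha with ha0 | ha0
  · subst ha0; nlinarith
  rcases eq_or_lt_of_le hb with hb0 | hb0
  · subst hb0; nlinarith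
  obtain ⟨A, c, γ, hA, hverts, hcont⟩ :=
    (FawziEtAl2015_sec4_ellipse_holds 4 4 (rectVertices a b) unitSquareNormals (fun _ => 1)
      (rectVertices_mem ha ha1 hb hb1) isBounded_unitSquare
      (rank_nestedRectangles ha0.ne' hb0.ne')).mp h
  have hsymm : A 1 0 = A 0 1 := by
    have := hA.1.apply 1 0
    rw [star_trivial] at this
    exact this.symm
  have hq : ∀ y : Fin 2 → ℝ, y ⬝ᵥ (A *ᵥ y) + 2 * (c ⬝ᵥ y) + γ =
      A 0 0 * y 0 ^ 2 + 2 * A 0 1 * y 0 * y 1 + A 1 1 * y 1 ^ 2 + 2 * (c 0 * y 0 + c 1 * y 1) + γ := by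
    intro y
    simp only [dotProduct, mulVec, Fin.sum_univ_two, hsymm]
    ring
  have h00 : 0 < A 0 0 := hA.diag_pos
  have h11 : 0 < A 1 1 := hA.diag_pos
  -- (i) averaging over the four vertices
  have hi : A 0 0 * a ^ 2 + A 1 1 * b ^ 2 + γ ≤ 0 := by
    have e0 := hverts 0
    have e1 := hverts 1
    have e2 := hverts 2
    have e3 := hverts 3
    rw [hq] at e0 e1 e2 e3
    simp [rectVertices] at e0 e1 e2 e3
    nlinarith [e0, e1, e2, e3]
  -- (ii) containment in the square along the axes
  have hii0 : -γ ≤ A 0 0 := by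
    by_contra hlt
    push Not at hlt
    have hpos : 1 < -γ / A 0 0 := by rw [lt_div_iff₀ h00]; linarith
    set t := Real.sqrt (-γ / A 0 0) with ht
    have ht1 : 1 < t := by
      rw [ht, show (1 : ℝ) = Real.sqrt 1 from Real.sqrt_one.symm]
      exact Real.sqrt_lt_sqrt zero_le_one hpos
    have ht2 : A 0 0 * t ^ 2 + γ = 0 := by
      rw [ht, Real.sq_sqrt (le_of_lt (lt_trans zero_lt_one hpos))]
      field_simp
      ring
    have hsum : (![t, 0] ⬝ᵥ (A *ᵥ ![t, 0]) + 2 * (c ⬝ᵥ ![t, 0]) + γ) +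
        (![-t, 0] ⬝ᵥ (A *ᵥ ![-t, 0]) + 2 * (c ⬝ᵥ ![-t, 0]) + γ) = 0 := by
      rw [hq, hq]
      simp
      linear_combination 2 * ht2
    rcases le_or_gt (![t, 0] ⬝ᵥ (A *ᵥ ![t, 0]) + 2 * (c ⬝ᵥ ![t, 0]) + γ) 0 with hle | hgt
    · have := hcont _ hle 0
      simp [unitSquareNormals, dotProduct, Fin.sum_univ_two] at this
      linarith
    · have hle' : ![-t, 0] ⬝ᵥ (A *ᵥ ![-t, 0]) + 2 * (c ⬝ᵥ ![-t, 0]) + γ ≤ 0 := by linarith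
      have := hcont _ hle' 2
      simp [unitSquareNormals, dotProduct, Fin.sum_univ_two] at this
      linarith
  have hii1 : -γ ≤ A 1 1 := by
    by_contra hlt
    push Not at hlt
    have hpos : 1 < -γ / A 1 1 := by rw [lt_div_iff₀ h11]; linarith
    set t := Real.sqrt (-γ / A 1 1) with ht
    have ht1 : 1 < t := by
      rw [ht, show (1 : ℝ) = Real.sqrt 1 from Real.sqrt_one.symm]
      exact Real.sqrt_lt_sqrt zero_le_one hpos
    have ht2 : A 1 1 * t ^ 2 + γ = 0 := by
      rw [ht, Real.sq_sqrt (le_of_lt (lt_trans zero_lt_one hpos))]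
      field_simp
      ring
    have hsum : (![0, t] ⬝ᵥ (A *ᵥ ![0, t]) + 2 * (c ⬝ᵥ ![0, t]) + γ) +
        (![0, -t] ⬝ᵥ (A *ᵥ ![0, -t]) + 2 * (c ⬝ᵥ ![0, -t]) + γ) = 0 := by
      rw [hq, hq]
      simp
      linear_combination 2 * ht2
    rcases le_or_gt (![0, t] ⬝ᵥ (A *ᵥ ![0, t]) + 2 * (c ⬝ᵥ ![0, t]) + γ) 0 with hle | hgt
    · have := hcont _ hle 1
      simp [unitSquareNormals, dotProduct, Fin.sum_univ_two] at this
      linarith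
    · have hle' : ![0, -t] ⬝ᵥ (A *ᵥ ![0, -t]) + 2 * (c ⬝ᵥ ![0, -t]) + γ ≤ 0 := by linarith
      have := hcont _ hle' 3
      simp [unitSquareNormals, dotProduct, Fin.sum_univ_two] at this
      linarith
  -- conclusion
  by_cases hγ : γ < 0
  · have h1 : (-γ) * (a ^ 2 + b ^ 2) ≤ A 0 0 * a ^ 2 + A 1 1 * b ^ 2 := by
      nlinarith [hii0, hii1, sq_nonneg a, sq_nonneg b]
    have h2 : (-γ) * (a ^ 2 + b ^ 2) ≤ (-γ) * 1 := by linarith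
    exact le_of_mul_le_mul_left h2 (by linarith)
  · nlinarith [mul_pos h00 (pow_pos ha0 2), mul_pos h11 (pow_pos hb0 2)]

/-- **Size 1 iff `a = b = 0`** (`1 × 1` psd factors are scalars, so `M` would have rank `≤ 1`, but
`(1+a)² = (1−a)²` and `(1+b)² = (1−b)²` on `2 × 2` minors). [cite: FawziEtAl2015, Example 3.6 (p10)] -/
theorem hasPsdFactorization_nestedRectangles_one_iff (a b : ℝ) :
    HasPsdFactorization (nestedRectanglesMatrix a b) 1 ↔ a = 0 ∧ b = 0 := by
  constructor
  · rintro ⟨A, B, -, -, hM⟩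
    rw [nestedRectanglesMatrix_eq] at hM
    have h : ∀ i j, (!![1 + a, 1 + b, 1 - a, 1 - b; 1 - a, 1 + b, 1 + a, 1 - b;
        1 - a, 1 - b, 1 + a, 1 + b; 1 + a, 1 - b, 1 - a, 1 + b] : Matrix (Fin 4) (Fin 4) ℝ) i j =
        A i 0 0 * B j 0 0 := by
      intro i j
      rw [hM i j]
      simp [trace, Matrix.mul_apply]
    have e00 := h 0 0
    have e02 := h 0 2
    have e10 := h 1 0
    have e12 := h 1 2
    have e01 := h 0 1
    have e03 := h 0 3
    have e21 := h 2 1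
    have e23 := h 2 3
    simp at e00 e02 e10 e12 e01 e03 e21 e23
    constructor
    · -- `(1+a)(1+a) = (1−a)(1−a)`
      have : (1 + a) * (1 + a) = (1 - a) * (1 - a) := by
        calc (1 + a) * (1 + a) = (A 0 0 0 * B 0 0 0) * (A 1 0 0 * B 2 0 0) := by rw [← e00, ← e12]
          _ = (A 0 0 0 * B 2 0 0) * (A 1 0 0 * B 0 0 0) := by ring
          _ = (1 - a) * (1 - a) := by rw [← e02, ← e10]
      nlinarith
    · have : (1 + b) * (1 + b) = (1 - b) * (1 - b) := by
        calc (1 + b) * (1 + b) = (A 0 0 0 * B 1 0 0) * (A 2 0 0 * B 3 0 0) := by rw [← e01, ← e23]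
          _ = (A 0 0 0 * B 3 0 0) * (A 2 0 0 * B 1 0 0) := by ring
          _ = (1 - b) * (1 - b) := by rw [← e03, ← e21]
      nlinarith
  · rintro ⟨rfl, rfl⟩
    refine ⟨fun _ => 1, fun _ => 1, fun _ => PosSemidef.one, fun _ => PosSemidef.one, fun i j => ?_⟩
    rw [nestedRectanglesMatrix_eq]
    fin_cases i <;> fin_cases j <;> simp

/-- **FGPRT Example 3.6** (p10): for `0 ≤ a, b ≤ 1`, `rank_psd M = 3` if `a² + b² > 1`, `= 2` if
`0 < a² + b² ≤ 1`, `= 1` if `a = b = 0` — as the three facts `rank_psd M ≤ 3`, `rank_psd M ≤ 2 ↔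
a² + b² ≤ 1`, `rank_psd M ≤ 1 ↔ a = b = 0`. [cite: FawziEtAl2015, Example 3.6 (p10)] -/
theorem nestedRectangles_psdRank {a b : ℝ} (ha : 0 ≤ a) (ha1 : a ≤ 1) (hb : 0 ≤ b) (hb1 : b ≤ 1) :
    HasPsdFactorization (nestedRectanglesMatrix a b) 3 ∧
      (HasPsdFactorization (nestedRectanglesMatrix a b) 2 ↔ a ^ 2 + b ^ 2 ≤ 1) ∧
      (HasPsdFactorization (nestedRectanglesMatrix a b) 1 ↔ a = 0 ∧ b = 0) :=
  ⟨hasPsdFactorization_nestedRectangles_three ha ha1 hb hb1,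
    ⟨sq_add_sq_le_one_of_hasPsdFactorization_two ha ha1 hb hb1, hasPsdFactorization_nestedRectangles_two⟩,
    hasPsdFactorization_nestedRectangles_one_iff a b⟩

end Literature.Combinatorics.Optimization
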